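import Mathlib.RingTheory.PowerSeries.Substitution
import Mathlib.RingTheory.Polynomial.Cyclotomic.Roots
import Mathlib.RingTheory.Polynomial.Cyclotomic.Eval
import Summits.BirchSwinnertonDyer.Rank1Residual.X11b.Three.DensityTorsionSig
import Summits.BirchSwinnertonDyer.Rank1Residual.X11b.Three.DensityThreePowerRoots
import HarnessLib

/-!
# X11b at `p = 3` (team N8/O2), LINE-W sub-target S16 = LW-L3′ DENSITY LEMMA, part (b), FIRST RUNG
# `k = 1` in r1's COUNTING CURRENCY: a non-zero `g ∈ ℤ_p⟦X_0⟧` vanishes at `O_g(1)` torsion points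
# `ζ − 1`, `ζ ∈ μ_{p^t}`, uniformly in `t` (cell `b2b-bsdres`, team `x11b3`, seat p2;
# LEAD DEAL #6 (R6-10) (b); statement of record `Three/DensityTorsionSig.lean`)

HONEST FRAMING (verbatim, cell `b2b-bsdres`, run/shared/lean/b2b/bsd-rank1-residual/): the goal of
the cell is to DELETE the COMBINATION-SHAPED residual classes for ALL analytic-rank `≤ 1` curves
over `ℚ` — "full BSD formula for every rank `≤ 1` curve in class `C`" assembled STRICTLY from
published theorems — so that the rank-`≤ 1` remainder becomes exactly the CONSTRUCTION-SHAPED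
classes, which are TYPED (missing-input Props), NOT attempted; this is not "finishing BSD".
Research route (team N8/O2: STEP L at `3 ‖ N`, LINE W); PURE ALGEBRA; nothing booked; no label
touched; X11b@3 stays OPEN (RESIDUAL-MAP §I O2). No named fact; no `sorry`.
THEOREMS ONLY; no definition.

HONEST LABEL (verbatim, LEAD DEAL #6 (R6-10)): 'certifies W3-INH's DENSITY step at p = 3 ONLY;
does NOT make MI-W3 available at 3 (tame datum ⊥ B-EW3; (β) vacuous at 3 as printed — kernel
p252575); LINE W's status string is unchanged by this file'. Moreover (r1 LINE-W v1.9f): the full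
statement (b) is a corollary IN PRINT of V. Serban, J. Théor. Nombres Bordeaux 30 (2018) Thm 2.14,
so the kernel certificate is optional bookkeeping, not a missing input.

## What

* **`Density.torsionZeroCount_one : TorsionZeroCount p 1`** — for `g ∈ ℤ_p⟦X_0⟧` non-zero,
  `#{a ∈ ℤ/p^t : Φ_{p^t}(1+X) ∣ g((1+X)^a − 1)} ≤ max 1 (deg P)` for every `t` (`g = p^μ · P · u`,
  DVR content + Weierstrass preparation). PROOF (all algebra): in the DOMAIN
  `𝒪_t = ℤ_p⟦X⟧/(Φ_{p^t}(1+X)) ≅ ℤ_p[X]/(Φ_{p^t}(1+X))` (Mathlib `IsDistinguishedAt.algEquivQuotient`;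
  Eisenstein ⇒ irreducible ⇒ prime) the class `ζ` of `1 + X` is a primitive `p^t`-th root of unity
  (`isRoot_cyclotomic_iff`); a vanishing slice makes `ζ^a − 1` a ROOT of `P` in `𝒪_t`; `a ↦ ζ^a − 1`
  is injective on `[0, p^t)`; a polynomial has `≤ deg` roots in a domain (`Polynomial.card_roots'`).
  Corollary `Density.torsionDense_one : TorsionDense p 1`. Rungs `k = 2, 3` are NOT in this file.

References: X. Wan, ANT 14 (2020) §5.8 [Wan2020]; V. Serban, *An infinitesimal p-adic multiplicative
Manin–Mumford conjecture*, JTNB 30 (2018) Thm 2.14 [Serban2018]; L. C. Washington, GTM 83, §7.1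
[Washington1997]; team files `cells/x11b3/LINE-W.md` v1.9f §LW-L3′, LEAD DEAL #6 (R6-10),
`HOME/b2b-bsdres-x11b3-r1/LWL3Sig.lean` (sha16 9f39c0ac4120e3b8).
-/

open Polynomial
open scoped PowerSeries

namespace Summit.BirchSwinnertonDyer.Rank1Residual.X11b.Three.Density

/-! ### §1 One variable: the slice is an honest one-variable substitution -/

section OneVariable

variable (p : ℕ) [Fact p.Prime]

/-- The substitution `X_0 ↦ X` identifying `ℤ_p⟦X_0⟧` (`MvPowerSeries (Fin 1)`) with `ℤ_p⟦X⟧`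
(`PowerSeries`), written as an `MvPowerSeries.subst`; it is undone by `X ↦ X_0`. [folklore] -/
theorem subst_X_subst_X (g : MvPowerSeries (Fin 1) ℤ_[p]) :
    MvPowerSeries.subst (fun _ : Unit => (MvPowerSeries.X (0 : Fin 1) : MvPowerSeries (Fin 1) ℤ_[p]))
      (MvPowerSeries.subst (fun _ : Fin 1 => (PowerSeries.X : PowerSeries ℤ_[p])) g) = g := by
  have h1 : MvPowerSeries.HasSubst (fun _ : Fin 1 => (PowerSeries.X : PowerSeries ℤ_[p])) :=
    MvPowerSeries.hasSubst_of_constantCoeff_zero fun _ => PowerSeries.constantCoeff_X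
  have h2 : MvPowerSeries.HasSubst
      (fun _ : Unit => (MvPowerSeries.X (0 : Fin 1) : MvPowerSeries (Fin 1) ℤ_[p])) :=
    MvPowerSeries.hasSubst_of_constantCoeff_zero fun _ => MvPowerSeries.constantCoeff_X _
  rw [MvPowerSeries.subst_comp_subst_apply h1 h2]
  have h3 : (fun s : Fin 1 => MvPowerSeries.subst
      (fun _ : Unit => (MvPowerSeries.X (0 : Fin 1) : MvPowerSeries (Fin 1) ℤ_[p]))
        (PowerSeries.X : PowerSeries ℤ_[p])) = MvPowerSeries.X := by
    funext s
    rw [show (PowerSeries.X : PowerSeries ℤ_[p]) = MvPowerSeries.X () from rfl,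
      MvPowerSeries.subst_X h2, Fin.fin_one_eq_zero s]
  rw [h3, MvPowerSeries.subst_self]
  rfl

/-- `X_0 ↦ X` is injective: a non-zero `g ∈ ℤ_p⟦X_0⟧` has non-zero one-variable avatar.
[folklore] -/
theorem subst_X_ne_zero {g : MvPowerSeries (Fin 1) ℤ_[p]} (hg : g ≠ 0) :
    MvPowerSeries.subst (fun _ : Fin 1 => (PowerSeries.X : PowerSeries ℤ_[p])) g ≠ 0 := by
  intro h0
  apply hg
  have := subst_X_subst_X p g
  rw [h0] at this
  rw [← this]
  have h2 : MvPowerSeries.HasSubst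
      (fun _ : Unit => (MvPowerSeries.X (0 : Fin 1) : MvPowerSeries (Fin 1) ℤ_[p])) :=
    MvPowerSeries.hasSubst_of_constantCoeff_zero fun _ => MvPowerSeries.constantCoeff_X _
  rw [← MvPowerSeries.coe_substAlgHom h2, map_zero]

/-- For `k = 1` the torsion slice along `a` is the one-variable substitution
`X ↦ (1+X)^{a 0} − 1` applied to the one-variable avatar of `g`. [folklore] -/
theorem torsionSlice_one_eq (a : Fin 1 → ℕ) (g : MvPowerSeries (Fin 1) ℤ_[p]) :
    torsionSlice p a g = PowerSeries.subst
      ((((1 : PowerSeries ℤ_[p]) + PowerSeries.X) ^ (a 0) - 1 : PowerSeries ℤ_[p]))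
      (MvPowerSeries.subst (fun _ : Fin 1 => (PowerSeries.X : PowerSeries ℤ_[p])) g) := by
  have h1 : MvPowerSeries.HasSubst (fun _ : Fin 1 => (PowerSeries.X : PowerSeries ℤ_[p])) :=
    MvPowerSeries.hasSubst_of_constantCoeff_zero fun _ => PowerSeries.constantCoeff_X
  have hb : PowerSeries.HasSubst
      ((((1 : PowerSeries ℤ_[p]) + PowerSeries.X) ^ (a 0) - 1 : PowerSeries ℤ_[p])) :=
    PowerSeries.HasSubst.of_constantCoeff_zero' (by simp)
  rw [PowerSeries.subst_def, MvPowerSeries.subst_comp_subst_apply h1 hb.const, torsionSlice]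
  congr 1
  funext i
  rw [Fin.fin_one_eq_zero i, ← PowerSeries.subst_def, PowerSeries.subst_X hb]

end OneVariable

/-! ### §2 The level-`p^{s+1}` quotient `𝒪 = ℤ_p⟦X⟧/(Φ_{p^{s+1}}(1+X))` is a domain of
characteristic zero in which `1 + X` is a primitive `p^{s+1}`-th root of unity -/

section Quotient

variable (p : ℕ) [hp : Fact p.Prime] (s : ℕ)

/-- `Φ_{p^{s+1}}(X+1)` over `ℤ_p` is the base change of the integral one. [folklore] -/
theorem cyclotomic_comp_eq_map :
    (cyclotomic (p ^ (s + 1)) ℤ_[p]).comp (X + 1) =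
      ((cyclotomic (p ^ (s + 1)) ℤ).comp (X + 1)).map (Int.castRingHom ℤ_[p]) := by
  rw [Polynomial.map_comp, map_cyclotomic_int, Polynomial.map_add, Polynomial.map_X,
    Polynomial.map_one]

/-- `p ∈ 𝔪_{ℤ_p}`. [folklore] -/
theorem natCast_mem_maximalIdeal : (p : ℤ_[p]) ∈ IsLocalRing.maximalIdeal ℤ_[p] := by
  rw [PadicInt.maximalIdeal_eq_span_p]
  exact Ideal.mem_span_singleton_self _

/-- `Φ_{p^{s+1}}(X+1)` is distinguished at `𝔪_{ℤ_p}` (Eisenstein). [cite: Washington1997, §7.1] -/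
theorem isDistinguishedAt_cyclotomic_comp :
    ((cyclotomic (p ^ (s + 1)) ℤ_[p]).comp (X + 1)).IsDistinguishedAt
      (IsLocalRing.maximalIdeal ℤ_[p]) := by
  rw [cyclotomic_comp_eq_map]
  exact isDistinguishedAt_cyclotomic_comp_X_add_one (natCast_mem_maximalIdeal p) s

/-- The degree of `Φ_{p^{s+1}}(X+1)` over `ℤ_p` is `p^s (p-1) > 0`. [folklore] -/
theorem natDegree_cyclotomic_comp :
    ((cyclotomic (p ^ (s + 1)) ℤ_[p]).comp (X + 1)).natDegree = p ^ s * (p - 1) := by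
  rw [cyclotomic_comp_eq_map]
  exact natDegree_cyclotomic_comp_X_add_one (p := p) s

/-- `Φ_{p^{s+1}}(X+1)` is irreducible over `ℤ_p` (Eisenstein at `p`: constant term
`Φ_{p^{s+1}}(1) = p ∉ (p²)`). [cite: Washington1997, Lemma 1.4 / §7.1] -/
theorem irreducible_cyclotomic_comp :
    Irreducible ((cyclotomic (p ^ (s + 1)) ℤ_[p]).comp (X + 1)) := by
  have hD := isDistinguishedAt_cyclotomic_comp p s
  have hmax : IsLocalRing.maximalIdeal ℤ_[p] = Ideal.span {(p : ℤ_[p])} :=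
    PadicInt.maximalIdeal_eq_span_p
  have hE : ((cyclotomic (p ^ (s + 1)) ℤ_[p]).comp (X + 1)).IsEisensteinAt
      (IsLocalRing.maximalIdeal ℤ_[p]) :=
    { leading := by
        rw [hD.monic.leadingCoeff]
        exact fun h1 => (Ideal.IsMaximal.ne_top inferInstance) (Ideal.eq_top_of_isUnit_mem _ h1
          isUnit_one)
      mem := fun hn => hD.mem hn
      notMem := by
        rw [Polynomial.coeff_zero_eq_eval_zero, Polynomial.eval_comp, Polynomial.eval_add,
          Polynomial.eval_X, Polynomial.eval_one, zero_add, eval_one_cyclotomic_prime_pow (p := p) s,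
          hmax,
          Ideal.span_singleton_pow, Ideal.mem_span_singleton]
        rintro ⟨c, hc⟩
        apply (PadicInt.irreducible_p (p := p)).not_isUnit
        have hp0 : (p : ℤ_[p]) ≠ 0 := by exact_mod_cast hp.out.ne_zero
        refine isUnit_of_dvd_one ⟨c, mul_left_cancel₀ hp0 ?_⟩
        rw [mul_one, ← mul_assoc, ← pow_two]
        exact hc }
  refine hE.irreducible inferInstance hD.monic.isPrimitive ?_
  rw [natDegree_cyclotomic_comp]
  exact Nat.mul_pos (pow_pos hp.out.pos _) (Nat.sub_pos_of_lt hp.out.one_lt)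

/-- `𝒪 = ℤ_p⟦X⟧/(Φ_{p^{s+1}}(1+X)) ≅ ℤ_p[X]/(Φ_{p^{s+1}}(1+X)) = ℤ_p[ζ_{p^{s+1}}]` is a domain
(Weierstrass division: Mathlib `IsDistinguishedAt.algEquivQuotient`; Eisenstein ⇒ irreducible ⇒
prime in the UFD `ℤ_p[X]`). [cite: Washington1997, Prop. 7.2] -/
theorem isDomain_quotient :
    IsDomain (PowerSeries ℤ_[p] ⧸ Ideal.span
      {(((cyclotomic (p ^ (s + 1)) ℤ_[p]).comp (X + 1) : ℤ_[p][X]) : PowerSeries ℤ_[p])}) := by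
  have hirr := irreducible_cyclotomic_comp p s
  haveI : (Ideal.span {(cyclotomic (p ^ (s + 1)) ℤ_[p]).comp (X + 1)}).IsPrime :=
    (Ideal.span_singleton_prime hirr.ne_zero).mpr hirr.prime
  haveI : IsDomain (ℤ_[p][X] ⧸ Ideal.span {(cyclotomic (p ^ (s + 1)) ℤ_[p]).comp (X + 1)}) :=
    (Ideal.Quotient.isDomain_iff_prime _).mpr inferInstance
  exact MulEquiv.isDomain (ℤ_[p][X] ⧸ Ideal.span {(cyclotomic (p ^ (s + 1)) ℤ_[p]).comp (X + 1)})
    (isDistinguishedAt_cyclotomic_comp p s).algEquivQuotient.symm.toMulEquiv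

/-- `𝒪` is a free `ℤ_p`-module (basis `1, X, …, X^{φ(p^{s+1})−1}`). [cite: Washington1997, Prop. 7.2] -/
theorem free_quotient :
    Module.Free ℤ_[p] (PowerSeries ℤ_[p] ⧸ Ideal.span
      {(((cyclotomic (p ^ (s + 1)) ℤ_[p]).comp (X + 1) : ℤ_[p][X]) : PowerSeries ℤ_[p])}) :=
  haveI := (isDistinguishedAt_cyclotomic_comp p s).monic.free_quotient
  Module.Free.of_equiv (isDistinguishedAt_cyclotomic_comp p s).algEquivQuotient.toLinearEquiv

/-- `p^{s+1} ≠ 0` in the `ℤ_p`-free domain `𝒪`. [folklore] -/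
theorem neZero_natCast_quotient :
    NeZero ((p ^ (s + 1) : ℕ) : PowerSeries ℤ_[p] ⧸ Ideal.span
      {(((cyclotomic (p ^ (s + 1)) ℤ_[p]).comp (X + 1) : ℤ_[p][X]) : PowerSeries ℤ_[p])}) := by
  haveI := isDomain_quotient p s
  haveI := free_quotient p s
  refine ⟨?_⟩
  rw [← map_natCast (algebraMap ℤ_[p] _), Algebra.algebraMap_eq_smul_one]
  exact smul_ne_zero (by exact_mod_cast pow_ne_zero _ hp.out.ne_zero) one_ne_zero

/-- **`ζ = 1 + X` is a primitive `p^{s+1}`-th root of unity in `𝒪 = ℤ_p⟦X⟧/(Φ_{p^{s+1}}(1+X))`**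
(`Φ_{p^{s+1}}(ζ) = 0` in a domain of characteristic `0`; `isRoot_cyclotomic_iff`). [folklore] -/
theorem isPrimitiveRoot_quotient :
    IsPrimitiveRoot (Ideal.Quotient.mk (Ideal.span
      {(((cyclotomic (p ^ (s + 1)) ℤ_[p]).comp (X + 1) : ℤ_[p][X]) : PowerSeries ℤ_[p])})
        (1 + PowerSeries.X)) (p ^ (s + 1)) := by
  haveI := isDomain_quotient p s
  haveI := neZero_natCast_quotient p s
  have hmap : cyclotomic (p ^ (s + 1)) (PowerSeries ℤ_[p] ⧸ Ideal.span
      {(((cyclotomic (p ^ (s + 1)) ℤ_[p]).comp (X + 1) : ℤ_[p][X]) : PowerSeries ℤ_[p])}) =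
      (cyclotomic (p ^ (s + 1)) ℤ_[p]).map (algebraMap ℤ_[p] _) :=
    (map_cyclotomic _ _).symm
  rw [← Polynomial.isRoot_cyclotomic_iff, hmap, Polynomial.IsRoot.def, Polynomial.eval_map,
    ← Polynomial.aeval_def, ← Ideal.Quotient.mkₐ_eq_mk ℤ_[p], Polynomial.aeval_algHom_apply,
    Ideal.Quotient.mkₐ_eq_mk, Ideal.Quotient.eq_zero_iff_mem, Ideal.mem_span_singleton]
  refine ⟨1, ?_⟩
  rw [mul_one, Polynomial.comp_eq_aeval, Polynomial.aeval_def, Polynomial.aeval_def,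
    ← Polynomial.coeToPowerSeries.ringHom_apply, Polynomial.hom_eval₂]
  congr 1
  · ext r
    simp [Polynomial.coe_C]
  · simp [add_comm]

end Quotient

/-! ### §3 Counting: vanishing slices give roots of the Weierstrass polynomial in `𝒪` -/

section Count

variable (p : ℕ) [hp : Fact p.Prime]

/-- A polynomial `P ∈ ℤ_p[X]`, seen in `ℤ_p⟦X⟧`, is `eval₂ C X P`. [folklore] -/
theorem coe_eq_eval₂ (P : ℤ_[p][X]) :
    (P : PowerSeries ℤ_[p]) = Polynomial.eval₂ (PowerSeries.C (R := ℤ_[p])) PowerSeries.X P := by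
  conv_lhs => rw [← Polynomial.eval₂_C_X (p := P)]
  rw [← Polynomial.coeToPowerSeries.ringHom_apply, Polynomial.hom_eval₂]
  congr 1
  · ext r
    simp [Polynomial.coe_C]
  · simp

/-- An algebra map out of `ℤ_p⟦X⟧` evaluates a polynomial at the image of `X`. [folklore] -/
theorem algHom_coe_eq_aeval {B : Type*} [CommRing B] [Algebra ℤ_[p] B]
    (ψ : PowerSeries ℤ_[p] →ₐ[ℤ_[p]] B) (P : ℤ_[p][X]) :
    ψ (P : PowerSeries ℤ_[p]) = Polynomial.aeval (ψ PowerSeries.X) P := by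
  rw [coe_eq_eval₂, ← AlgHom.coe_toRingHom, Polynomial.hom_eval₂, Polynomial.aeval_def]
  congr 1
  ext r
  change ψ (PowerSeries.C r) = algebraMap ℤ_[p] B r
  rw [← AlgHom.commutes ψ r, PowerSeries.algebraMap_eq]

/-- **The count at level `p^{s+1}`.** For `g ∈ ℤ_p⟦X_0⟧` with one-variable avatar
`G = a₀ • (P · u)` (`a₀ ≠ 0`, `P` monic — e.g. distinguished —, `u` a unit), the number of exponents
`a ∈ [0, p^{s+1})` with `Φ_{p^{s+1}}(1+X) ∣ g((1+X)^a − 1)` is at most `deg P`: each such `a` makes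
`ζ^a − 1` a root of `P` in the domain `𝒪 = ℤ_p⟦X⟧/(Φ_{p^{s+1}}(1+X))`, and `a ↦ ζ^a − 1` is injective
there (`ζ` primitive of order `p^{s+1}`). [cite: Washington1997, §7.1] -/
theorem torsionZeroCount_succ_le (g : MvPowerSeries (Fin 1) ℤ_[p]) {a₀ : ℤ_[p]} (ha₀ : a₀ ≠ 0)
    {P : ℤ_[p][X]} (hP : P.Monic) {u : PowerSeries ℤ_[p]} (hu : IsUnit u)
    (hG : MvPowerSeries.subst (fun _ : Fin 1 => (PowerSeries.X : PowerSeries ℤ_[p])) g =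
      a₀ • ((P : PowerSeries ℤ_[p]) * u))
    (s : ℕ) : torsionZeroCount p (s + 1) g ≤ P.natDegree := by
  classical
  haveI := isDomain_quotient p s
  haveI := free_quotient p s
  set J : Ideal (PowerSeries ℤ_[p]) := Ideal.span
    {(((cyclotomic (p ^ (s + 1)) ℤ_[p]).comp (X + 1) : ℤ_[p][X]) : PowerSeries ℤ_[p])} with hJ
  set ζ := Ideal.Quotient.mk J (1 + PowerSeries.X) with hζdef
  have hζ : IsPrimitiveRoot ζ (p ^ (s + 1)) := isPrimitiveRoot_quotient p s
  set P' := P.map (algebraMap ℤ_[p] (PowerSeries ℤ_[p] ⧸ J)) with hP'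
  have hP'0 : P' ≠ 0 := (hP.map _).ne_zero
  -- every vanishing exponent `a` gives a root `ζ^a − 1` of `P'`
  have key : ∀ a : ℕ, (((cyclotomic (p ^ (s + 1)) ℤ_[p]).comp (X + 1) : ℤ_[p][X]) :
      PowerSeries ℤ_[p]) ∣ PowerSeries.subst
        ((((1 : PowerSeries ℤ_[p]) + PowerSeries.X) ^ a - 1 : PowerSeries ℤ_[p]))
        (MvPowerSeries.subst (fun _ : Fin 1 => (PowerSeries.X : PowerSeries ℤ_[p])) g) →
      P'.IsRoot (ζ ^ a - 1) := by
    intro a hdvd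
    have hb : PowerSeries.HasSubst
        ((((1 : PowerSeries ℤ_[p]) + PowerSeries.X) ^ a - 1 : PowerSeries ℤ_[p])) :=
      PowerSeries.HasSubst.of_constantCoeff_zero' (by simp)
    let ψ : PowerSeries ℤ_[p] →ₐ[ℤ_[p]] (PowerSeries ℤ_[p] ⧸ J) :=
      (Ideal.Quotient.mkₐ ℤ_[p] J).comp (PowerSeries.substAlgHom hb)
    have hψ : ∀ F : PowerSeries ℤ_[p], ψ F = Ideal.Quotient.mk J (PowerSeries.subst
        ((((1 : PowerSeries ℤ_[p]) + PowerSeries.X) ^ a - 1 : PowerSeries ℤ_[p])) F) := fun F => by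
      simp only [ψ, AlgHom.comp_apply, Ideal.Quotient.mkₐ_eq_mk, PowerSeries.coe_substAlgHom]
    have hψX : ψ PowerSeries.X = ζ ^ a - 1 := by
      rw [hψ, PowerSeries.subst_X hb, map_sub, map_pow, map_one]
    have hψG : ψ (a₀ • ((P : PowerSeries ℤ_[p]) * u)) = 0 := by
      rw [hψ, Ideal.Quotient.eq_zero_iff_mem, hJ, Ideal.mem_span_singleton, ← hG]
      exact hdvd
    have hψP : ψ (P : PowerSeries ℤ_[p]) = 0 := by
      have h1 : a₀ • (ψ (P : PowerSeries ℤ_[p]) * ψ u) = 0 := by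
        rw [← map_mul, ← map_smul]
        exact hψG
      have h2 : ψ (P : PowerSeries ℤ_[p]) * ψ u = 0 := (smul_eq_zero.mp h1).resolve_left ha₀
      exact (hu.map ψ).mul_left_eq_zero.mp h2
    rw [Polynomial.IsRoot.def, hP', Polynomial.eval_map, ← Polynomial.aeval_def, ← hψX,
      ← algHom_coe_eq_aeval]
    exact hψP
  -- the injection `a ↦ ζ^(a 0) − 1` into the roots of `P'`
  calc torsionZeroCount p (s + 1) g
      ≤ (↑P'.roots.toFinset : Set (PowerSeries ℤ_[p] ⧸ J)).ncard := by
        apply Set.ncard_le_ncard_of_injOn (fun a : Fin 1 → Fin (p ^ (s + 1)) => ζ ^ ((a 0 : ℕ)) - 1)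
        · intro a ha
          have ha' : VanishesAtTorsion p (s + 1) (fun i => ((a i : Fin (p ^ (s + 1))) : ℕ)) g := ha
          rw [VanishesAtTorsion, torsionSlice_one_eq] at ha'
          rw [Finset.mem_coe, Multiset.mem_toFinset, Polynomial.mem_roots hP'0]
          exact key _ ha'
        · intro a _ a' _ h
          have h' : ζ ^ ((a 0 : ℕ)) = ζ ^ ((a' 0 : ℕ)) := sub_left_injective h
          have h0 : (a 0 : ℕ) = (a' 0 : ℕ) := hζ.pow_inj (a 0).isLt (a' 0).isLt h'
          funext i
          rw [Fin.fin_one_eq_zero i]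
          exact Fin.ext h0
    _ = P'.roots.toFinset.card := Set.ncard_coe_finset _
    _ ≤ P'.roots.card := Multiset.toFinset_card_le _
    _ ≤ P'.natDegree := Polynomial.card_roots' _
    _ ≤ P.natDegree := Polynomial.natDegree_map_le

/-- **LW-L3′ (b), rung `k = 1`: `TorsionZeroCount p 1`.** A non-zero `g ∈ ℤ_p⟦X_0⟧` vanishes at a
BOUNDED number of torsion points of level `≤ t`, uniformly in `t`: with `g = p^μ · P · u`
(DVR content + Weierstrass preparation) the bound is `max 1 (deg P)`. (HONEST LABEL: certifies
W3-INH's density step at `p = 3` only, first rung; MI-W3 is NOT made available at `3`; LINE W's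
status string unchanged; in print: Serban 2018 Thm 2.14.) [cite: Washington1997, §7.1 (Thm. 7.3)]
[cite: Wan2020, §5.8] -/
theorem torsionZeroCount_one : TorsionZeroCount p 1 := by
  intro g hg
  have hG := subst_X_ne_zero p hg
  obtain ⟨a₀, G₀, ha₀, hGa, hG₀⟩ := exists_eq_smul_of_ne_zero hG
  obtain ⟨P, u, hW⟩ := PowerSeries.exists_isWeierstrassFactorization hG₀
  have hGa' : MvPowerSeries.subst (fun _ : Fin 1 => (PowerSeries.X : PowerSeries ℤ_[p])) g =
      a₀ • ((P : PowerSeries ℤ_[p]) * u) := by rw [hGa, hW.eq_mul]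
  refine ⟨max 1 P.natDegree, fun t => ?_⟩
  rw [Nat.sub_self, zero_mul, pow_zero, mul_one]
  cases t with
  | zero =>
    refine le_trans ?_ (le_max_left _ _)
    calc torsionZeroCount p 0 g ≤ (Set.univ : Set (Fin 1 → Fin (p ^ 0))).ncard :=
          Set.ncard_le_ncard (Set.subset_univ _)
      _ = 1 := by simp [Set.ncard_univ]
  | succ s =>
    exact (torsionZeroCount_succ_le p g ha₀ hW.isDistinguishedAt.monic hW.isUnit hGa' s).trans
      (le_max_right _ _)

/-- **LW-L3′ (b′), rung `k = 1`: `TorsionDense p 1`** — a family of sets of torsion points of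
unbounded size is Zariski dense in `Spf ℤ_p⟦X_0⟧` (only `g = 0` vanishes on all of them).
[cite: Washington1997, §7.1] [cite: Wan2020, §5.8] -/
theorem torsionDense_one : TorsionDense p 1 :=
  torsionDense_of_count p 1 (torsionZeroCount_one p)

end Count

end Summit.BirchSwinnertonDyer.Rank1Residual.X11b.Three.Density
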